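/-
Copyright (c) 2026 the pub-hodgecm-mathlib formalisation cell (harness21).  Prover seat hodgecm-mathlib-LH7-p10 (g2), req620 Track A «(D-RAM) FOUR-FRAME» squad
((β₂) road (R-36) «PURE-CELL LEDGER», lane C = type RamM: the twin of LH4-p13 (g9)'s ★ `F0P3cDyRamTopConeCellEmpty` — the HIGH band of the `hTopC` socket of LH4-p12 (g8)'s
★ p863526 (OFF_C) dispatch), 2026-09-05.
-/
import Summits.HodgeConjecture.HodgeConjecture.Theorems.F0P3cDyRamConeCellPresentation        -- ★ p862869 (LH7-p09 (g2)): the JUNCTION `exists_presentation_of_mem_levelSetDep`; brings ★ `…ShellLineModel`, ★ DEFS `levelSetDep`, `forall_herm_mul_mem_iff_isOrd_div`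
import Summits.HodgeConjecture.HodgeConjecture.Theorems.F0P3cDyRamTopConeCellOffShellRamM      -- (this seat, prequel): `not_latticeNearTransvShell_of_top_ramM` (above the row the square token fails, v_M units)
import HarnessLib

/-!
# Crux `H413`, line LH4 «(D-RAM) FOUR-FRAME» — the (β₂) road (R-36), lane C (type RamM), socket `hTopC` of LH4-p12 (g8)'s (OFF_C) dispatch ★ p863526, HIGH BAND:
# «A HIGH TOP-LINE CONE CELL OF THE RamM LEDGER HAS NO VERTEX ON ANY `(ℓ, k)` SHELL» — the fold of `…TopConeCellOffShellRamM` at the cell, through LH7-p09 (g2)'s junction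

Cell `hodgecm-mathlib` (D-0151), FLOOR 0, crux item H413 = `stmt-HodgeConjecture-24833`, route of record `HCCMUnconditional`; squads F0∕P3c∕LH4 + LH7; lane
`--supports stmt-HodgeConjecture-24833 --as helper` (count-neutral; pays NO tier-0 row).  THEOREMS ONLY (no `def`, no instance, no notation, no `sorry`, default heartbeats);
★-only imports; states NO law; (β₂) stays a HYPOTHESIS.  DATUM-FREE: ★ p861044∕p861305's block frame (plane `(E², H₂)`, `σ` an isometric involution, `H₂` hermitian with unit
determinant, middle entry `h_W` a unit, `|ϖ| = exp(−1)`), the line model `(M, jE, ρ, Θ, α; φ, lam, h)` with `jE` RAMIFIED (`|jE a| = |a|²`, the RamM place package's `c5 c6 c7`: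
`|α − ρα| = |ϖM − ρϖM| = exp(−d_ρ)`), ★ DEFS `levelSetDep`.

WHY (LH4-p12 (g8)'s ★ p863526 `cellDiff_offRowC_eq_zero_of_pieces`, socket `hTopC : ∀ j b, 1 ≤ b → b ≤ j → m < 4b → jl + 2b = 2j + dρ + m → ‹live› → lam ∈ 𝒪_j → cellDiff(j, b) = 0`;
this seat's ✋ 00:25:10Z).  As in lane B (LH4-p13 (g9), squad bus 2026-09-04T23:02:35Z) the top line splits in three bands, here in v_M units (the digit of `…TopConeCellOffShellRamM`
fails the square token at E-level `k` iff `m < 2b + k` on the line): HIGH `m < 2b + m⋆` — no vertex on either shell (THIS FILE); MID `2b + m⋆ ≤ m < 2b + m_c`; LOW `2b + m_c ≤ m` —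
genuinely labelled (balance road).  For a cone cell `(j, b)` (`1 ≤ b`, `lam ∈ 𝒪_j`) whose ‹OFF_C› tokens `|μ| = exp(−m)`, `|μ − ρμ| = exp(−jl)` (`μ = lam − jE u₀₀`) satisfy
`jl + m < 2j + d_ρ + 2b + 2k`, and with `|(lam − 1) + (jE u₀₀ − 1)| ≤ |jE ϖ|^k`, the subset of `levelSetDep(j, b; μ)` cut out by «some self-dual glued vertex with `W`-part `ι_W B`, tube `b`,
on the `(ℓ, k)` shell (and any trailing label `P`)» is EMPTY — for EVERY `ℓ` and every `P`.
* §1 FOLD `levelSetDep_inter_shell_eq_empty_of_top_ramM` (frame of the junction + `hjϖ`, `hαρ`; tokens `hm hjl`; `hν`, `htop`; any `ℓ k P`).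
* §2 HEAD (U-hi)_C `cellDiff_topHi_eq_zero_ramM` in ‹OFF_C.letter.v2›'s one-literal currency: `2·m_c ≤ m` (fence), `1 ≤ b`, `jl + 2b = 2j + d_ρ + m`, `m < 2b + m⋆`, `lam ∈ 𝒪_j` ⟹
  `cellDiff(j, b) = 0` (`+` at `(d % 2, m⋆)`, `−′` at `(d % 2, m_c)`; `|ν| ≤ |jE ϖ|^{m_c}` from `2m_c ≤ m`, `hum`, `|2| = |ϖ|^{t_E}`, `m_c ≤ m⋆ + t_E`).
WHAT IS NOT CLAIMED.  The MID band's `+` subset (needs (α′)₂ ★ p861941 and the unitary frame — sequel `…TopConeCellMidRamM`) and the LOW band (balance); which top cells are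
populated; any census law.
HONEST LABEL.  Count-neutral lattice bookkeeping; nothing printed is asserted; `HC_CM` is proved only modulo the 7 printed citations (2 remaining named inputs: hLiu418 =
`stmt-HodgeConjecture-24832`, h413 = `stmt-HodgeConjecture-24833`) until rung 0 closes.
## References
* [Kottwitz1986BaseChangeUnits] R. E. Kottwitz, *Base change for unit elements of Hecke algebras*, Compositio Math. 60 (1986): §1 pp. 240–241 (congruence-level pieces as lattice conditions).
* [Jacobowitz1962] R. Jacobowitz, *Hermitian forms over local fields*, Amer. J. Math. 84 (1962): §4 (duals, modular components, gluing).
* [Serre1979] J.-P. Serre, *Local Fields*, GTM 67 (1979): Ch. III §6 Prop. 12 (orders of conductor `c`).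
* [Rogawski1990] J. D. Rogawski, *Automorphic Representations of Unitary Groups in Three Variables*, Ann. of Math. Stud. 123 (1990): §4.9 Prop. 4.9.1 (b) p. 55.
-/

set_option autoImplicit false

noncomputable section

namespace Summit.HodgeConjecture.HodgeConjecture.Cruxes.H413.F0P3cDyRamTopConeCellEmptyRamM

open scoped Valued WithZero Matrix MatrixGroups
open WithZero
open Literature.NumberTheory.Automorphic Literature.NumberTheory.Automorphic.HermitianLattice Literature.NumberTheory.Automorphic.UnitaryLatticeTree
open Literature.NumberTheory.Rogawski1990
open Summit.HodgeConjecture.HodgeConjecture.Cruxes.H413.F0P3cDyRamToricCensusDefs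
open Summit.HodgeConjecture.HodgeConjecture.Cruxes.H413.F0P3cDyRamFourFrameCensusDefs (LatticeInLevel LatticeNearTransvShell)
open Summit.HodgeConjecture.HodgeConjecture.Cruxes.H413.F0P3cDyRamConeCellPresentation (exists_presentation_of_mem_levelSetDep)
open Summit.HodgeConjecture.HodgeConjecture.Cruxes.H413.F0P3cDyRamTopConeCellOffShellRamM (not_latticeNearTransvShell_of_top_ramM)
open Literature.NumberTheory.Automorphic.UnitaryThreeFourFrame (IsRamifiedQuadraticDatum)
open Literature.NumberTheory.LocalFields.WildQuadraticDatum (d_le_succ_t)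
open Summit.HodgeConjecture.HodgeConjecture.Cruxes.H413.F0P3cDyRamFourFramePieces
open Summit.HodgeConjecture.HodgeConjecture.Cruxes.H413.F0P3cDyRamStageOneBDefs (mcOfRecord mstarOfRecord_le_mcOfRecord)

variable {E M : Type} [Field E] [Valued E ℤᵐ⁰] [Field M] [Valued M ℤᵐ⁰] {ρ Θ : M →+* M} {α : M}

/-- **FOLD, RamM LANE — A HIGH TOP CONE CELL HAS NO VERTEX ON ANY `(ℓ, k)` SHELL** (any `q`, any `d`, any `ℓ`).  Block frame + line model (the junction's letters VERBATIM; `jE`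
RAMIFIED: `hjϖ : |jE ϖ| = exp(−2)`, `hαρ : |α − ρα| = exp(−d_ρ)` in place of lane B's `hjiso`, `|α − ρα| = 1`); cone cell `(j, b)` with `1 ≤ b` and `lam ∈ 𝒪_j`; the ‹OFF_C› tokens
`hm : |μ| = exp(−m)`, `hjl : |μ − ρμ| = exp(−jl)` (`μ = lam − jE u₀₀`, v_M units); smallness `hν : |(lam − 1) + (jE u₀₀ − 1)| ≤ |jE ϖ|^k`; and `htop : jl + m < 2j + d_ρ + 2b + 2k` (on the
lane-C top line `jl + 2b = 2j + d_ρ + m`: `m < 2b + k`).  THEN the subset of `levelSetDep(j, b; μ)` cut out by `∃ B, φ B = Λ ∧ ∃ L₃, SD ∧ L₃ ∩ W = ι_W B ∧ tube_b ∧ (LatticeNearTransvShell ϖ ℓ k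
(Γ − 1) L₃ ∧ P L₃)` is `∅`, for every trailing predicate `P` (LH7-p09 (g2)'s junction ★ p862869 presents the vertex, ★ DEFS `forall_herm_mul_mem_iff_isOrd_div` reads the depth clause,
`not_latticeNearTransvShell_of_top_ramM` denies the shell). [cite: Kottwitz1986BaseChangeUnits, §1 pp. 240–241] [cite: Jacobowitz1962, §4] [cite: Rogawski1990, §4.9 Prop. 4.9.1 (b) p. 55] -/
theorem levelSetDep_inter_shell_eq_empty_of_top_ramM
    (σ : E →+* E) (hσ : ∀ a, σ (σ a) = a) (hvσ : ∀ a, Valued.v (σ a) = Valued.v a) {ϖ : E} (hϖ : Valued.v ϖ = exp (-1 : ℤ))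
    {H₂ : Matrix (Fin 2) (Fin 2) E} (hH₂ : IsUnit H₂.det) (hH₂σ : (H₂.map σ)ᵀ = H₂) {hW : E} (hhW : Valued.v hW = 1)
    (jE : E →+* M) (hρρ : ∀ x, ρ (ρ x) = x) (hvρ : ∀ x, Valued.v (ρ x) = Valued.v x) (hα : ρ α ≠ α) (hα1 : Valued.v α ≤ 1)
    (hint : ∀ z : M, Valued.v z ≤ 1 → Valued.v ((z - ρ z) / (α - ρ α)) ≤ 1)
    (hΘΘ : ∀ x, Θ (Θ x) = x) (hΘρ : ∀ x, Θ (ρ x) = ρ (Θ x)) (hvΘ : ∀ x, Valued.v (Θ x) = Valued.v x)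
    (hjv : ∀ c, Valued.v (jE c) ≤ 1 ↔ Valued.v c ≤ 1) (hjfix : ∀ z, ρ z = z ↔ ∃ c, jE c = z)
    (hjpow : ∀ (t : E) (n : ℤ), Valued.v (jE t) = Valued.v (jE ϖ) ^ n ↔ Valued.v t = Valued.v ϖ ^ n)
    (hϖmax : ∀ t : M, ρ t = t → Valued.v t < 1 → Valued.v t ≤ Valued.v (jE ϖ)) (hjϖ : Valued.v (jE ϖ) = exp (-2 : ℤ))
    (φ : (Fin 2 → E) →+ M) (hφs : ∀ (c : E) (x : Fin 2 → E), φ (c • x) = jE c * φ x) (hφi : Function.Injective φ) (hφo : Function.Surjective φ)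
    {γ₂ : GL (Fin 2) E} {lam h : M} (hφγ : ∀ x, φ ((γ₂ : Matrix (Fin 2) (Fin 2) E).mulVec x) = lam * φ x) (hlam : Valued.v lam = 1)
    (hΘh : Θ h = h) (hh : h ≠ 0) (hform : ∀ x y, jE (pairing σ H₂ x y) = h * Θ (φ x) * φ y + ρ (h * Θ (φ x) * φ y))
    (u : GL (Fin 1) E) {b j : ℕ} (hb1 : 1 ≤ b) (hlamj : IsOrd ρ α (jE ϖ ^ j) lam) {m jl k dρ : ℕ}
    (hm : Valued.v (lam - jE ((u : Matrix (Fin 1) (Fin 1) E) 0 0)) = WithZero.exp (-(m : ℤ)))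
    (hjl : Valued.v ((lam - jE ((u : Matrix (Fin 1) (Fin 1) E) 0 0)) - ρ (lam - jE ((u : Matrix (Fin 1) (Fin 1) E) 0 0))) = WithZero.exp (-(jl : ℤ)))
    (hαρ : Valued.v (α - ρ α) = WithZero.exp (-(dρ : ℤ)))
    (hν : Valued.v ((lam - 1) + (jE ((u : Matrix (Fin 1) (Fin 1) E) 0 0) - 1)) ≤ Valued.v (jE ϖ) ^ k)
    (htop : jl + m < 2 * j + dρ + 2 * b + 2 * k) (ℓ : ℕ) (P : Submodule 𝒪[E] (Fin 3 → E) → Prop) :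
    levelSetDep ρ Θ α (jE ϖ) h j b (lam - jE ((u : Matrix (Fin 1) (Fin 1) E) 0 0)) ∩
        {Λ | ∃ B : Submodule 𝒪[E] (Fin 2 → E), B.toAddSubgroup.map φ = Λ ∧
          ∃ L₃ : Submodule 𝒪[E] (Fin 3 → E), IsSelfDualLattice σ ϖ (!![H₂ 0 0, 0, H₂ 0 1; 0, hW, 0; H₂ 1 0, 0, H₂ 1 1] : Matrix (Fin 3) (Fin 3) E) L₃ ∧
            L₃ ⊓ LinearMap.ker ((LinearMap.proj (1 : Fin 3) : (Fin 3 → E) →ₗ[E] E).restrictScalars 𝒪[E]) =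
              B.map ((Matrix.toLin' (!![1, 0; 0, 0; 0, 1] : Matrix (Fin 3) (Fin 2) E)).restrictScalars 𝒪[E]) ∧
            (∀ c : E, (Pi.single 1 c : Fin 3 → E) ∈ L₃ ↔ Valued.v c ≤ Valued.v ϖ ^ b) ∧
            (LatticeNearTransvShell ϖ ℓ k ((((endoGL (γ₂, u) : GL (Fin 3) E) : Matrix (Fin 3) (Fin 3) E) - 1)) L₃ ∧ P L₃)} = ∅ := by
  have hjϖ0 : jE ϖ ≠ 0 := fun h0 => by rw [h0, map_zero] at hjϖ; exact zero_ne_coe hjϖ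
  have hjϖle : Valued.v (jE ϖ) ≤ 1 := by rw [hjϖ, ← exp_zero, exp_le_exp]; norm_num
  -- the order parameter `cc = ϖE^j`
  have hc : ρ (jE ϖ ^ j) = jE ϖ ^ j := by rw [← map_pow]; exact (hjfix _).2 ⟨ϖ ^ j, rfl⟩
  have hc0 : jE ϖ ^ j ≠ 0 := pow_ne_zero j hjϖ0
  have hc1 : Valued.v (jE ϖ ^ j) ≤ 1 := by rw [map_pow]; exact pow_le_one₀ zero_le hjϖle
  refine Set.subset_empty_iff.1 fun Λ hΛ => ?_
  obtain ⟨hΛ, B, hBΛ, L₃, hL, hLB, htube, hshell, -⟩ := hΛ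
  obtain ⟨x₀, w₀, g₀, hx₀, hΛx, -, -, hylev, hw₀Y, hpr, hg₀, hg₀1, hprg⟩ :=
    exists_presentation_of_mem_levelSetDep σ hσ hvσ hϖ hH₂ hH₂σ hhW jE hρρ hvρ hα hα1 hint hΘΘ hΘρ hvΘ hjv hjfix hjpow hϖmax φ hφs hφi hφo hφγ hlam hΘh hh hform
      ((u : Matrix (Fin 1) (Fin 1) E) 0 0) hb1 hlamj hΛ hBΛ hL hLB htube
  -- the cell's depth clause in `Y`-currency
  have hz : IsOrd ρ α (jE ϖ ^ j) ((lam - jE ((u : Matrix (Fin 1) (Fin 1) E) 0 0)) / dualGen ρ Θ α (jE ϖ ^ j) h x₀) :=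
    (forall_herm_mul_mem_iff_isOrd_div hρρ hvρ hα hα1 hint hΘΘ hΘρ hvΘ hc hc0 hc1 hh hx₀ hΛx _).1 ((mem_levelSetDep_iff ρ Θ α (jE ϖ) h j b _ Λ).1 hΛ).2
  exact not_latticeNearTransvShell_of_top_ramM hvρ hϖ jE hjϖ hjfix φ hφs hφi hφγ htube hpr hLB.symm hg₀ hg₀1 hprg hBΛ hx₀ hΛx hw₀Y hylev u hm hjl hαρ hz hν htop ℓ
    hshell

/-! ## §2 The HIGH band of socket `hTopC` at the cell, in ‹OFF_C.letter.v2›'s one-literal currency -/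

/-- **(U-hi)_C «A HIGH TOP-LINE CONE CELL OF THE RamM LEDGER CONTRIBUTES ZERO» — in ‹OFF_C.letter.v2›'s ONE-LITERAL GENERAL-BLOCK currency** (the HIGH band of the `hTopC`
socket of LH4-p12 (g8)'s ★ p863526: letters `j b`, `1 ≤ b`, the top line `jl + 2b = 2j + d_ρ + m`, the band `m < 2b + m⋆`, `lam ∈ 𝒪_j`; preceded by the context letter `2·m_c ≤ m`,
which the lane-C (OFF_C) wrapper reads off the fence `N d tE ≥ 2·m_c(d)`).  Block frame + line model (‹OFF_C›'s binder names), the ramified datum `hD` on `E` (for `|2| = |ϖ|^t`,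
`d ≤ t + 1`), the RamM letters `c1 : |jE a| = |a|²`, `c5 c6 c7` (`|α − ρα| = exp(−d_ρ)`), the tokens `hm hjl`, `hum`.  THEN `cellDiff(j, b) = 0`: both labelled subsets of the cell are
`∅` (§1 at `k = m⋆` with `|ν| ≤ |jE ϖ|^{m⋆}`, resp. `k = m_c` with `|ν| ≤ |jE ϖ|^{m_c}` from `2m_c ≤ m`, `hum` and `m_c ≤ m⋆ + t`; `m < 2b + m⋆ ≤ 2b + m_c`), so both finsums vanish
(`finsum_mem_empty`). [cite: Kottwitz1986BaseChangeUnits, §1 pp. 240–241] [cite: Rogawski1990, §4.9 Prop. 4.9.1 (b) p. 55] [cite: Serre1979, Ch. III §6 Prop. 12] -/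
theorem cellDiff_topHi_eq_zero_ramM
    (σ : E →+* E) {ϖ : E} {d tE : ℕ} (hD : IsRamifiedQuadraticDatum σ ϖ d tE)
    {H₂ : Matrix (Fin 2) (Fin 2) E} (hH₂ : IsUnit H₂.det) (hH₂σ : (H₂.map σ)ᵀ = H₂) {hW : E} (hhW : Valued.v hW = 1)
    (jE : E →+* M) (hρρ : ∀ x, ρ (ρ x) = x) (hvρ : ∀ x, Valued.v (ρ x) = Valued.v x) (hα : ρ α ≠ α) (hα1 : Valued.v α ≤ 1)
    (hint : ∀ z : M, Valued.v z ≤ 1 → Valued.v ((z - ρ z) / (α - ρ α)) ≤ 1)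
    (hΘΘ : ∀ x, Θ (Θ x) = x) (hΘρ : ∀ x, Θ (ρ x) = ρ (Θ x)) (hvΘ : ∀ x, Valued.v (Θ x) = Valued.v x)
    (hjv : ∀ c, Valued.v (jE c) ≤ 1 ↔ Valued.v c ≤ 1) (hjfix : ∀ z, ρ z = z ↔ ∃ c, jE c = z)
    (hjpow : ∀ (t : E) (n : ℤ), Valued.v (jE t) = Valued.v (jE ϖ) ^ n ↔ Valued.v t = Valued.v ϖ ^ n)
    (hϖmax : ∀ t : M, ρ t = t → Valued.v t < 1 → Valued.v t ≤ Valued.v (jE ϖ))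
    (c1 : ∀ a, Valued.v (jE a) = Valued.v a ^ 2) {ϖM : M} {dρ : ℕ} (c5 : Valued.v ϖM = WithZero.exp (-1 : ℤ)) (c6 : α - ρ α = ϖM - ρ ϖM)
    (c7 : IsRamifiedQuadraticDatum ρ ϖM dρ (2 * tE))
    (φ : (Fin 2 → E) →+ M) (hφs : ∀ (c : E) (x : Fin 2 → E), φ (c • x) = jE c * φ x) (hφi : Function.Injective φ) (hφo : Function.Surjective φ)
    {γ₂ : GL (Fin 2) E} {lam h : M} (hφγ : ∀ x, φ ((γ₂ : Matrix (Fin 2) (Fin 2) E).mulVec x) = lam * φ x) (hlam : Valued.v lam = 1)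
    (hΘh : Θ h = h) (hh : h ≠ 0) (hform : ∀ x y, jE (pairing σ H₂ x y) = h * Θ (φ x) * φ y + ρ (h * Θ (φ x) * φ y))
    (u : GL (Fin 1) E) (hum : Valued.v (((u : Matrix (Fin 1) (Fin 1) E) 0 0) - 1) ≤ Valued.v (ϖ ^ mstarOfRecord d))
    {m jl : ℕ} (hm : Valued.v (lam - jE ((u : Matrix (Fin 1) (Fin 1) E) 0 0)) = WithZero.exp (-(m : ℤ)))
    (hjl : Valued.v ((lam - jE ((u : Matrix (Fin 1) (Fin 1) E) 0 0)) - ρ (lam - jE ((u : Matrix (Fin 1) (Fin 1) E) 0 0))) = WithZero.exp (-(jl : ℤ)))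
    (f : ℕ → ℕ → AddSubgroup M → ℕ) (hmcm : 2 * mcOfRecord d ≤ m) (j b : ℕ) (hb1 : 1 ≤ b) (hline : jl + 2 * b = 2 * j + dρ + m)
    (hband : m < 2 * b + mstarOfRecord d) (hlamj : IsOrd ρ α (jE ϖ ^ j) lam) :
    ((∑ᶠ Λ ∈ levelSetDep ρ Θ α (jE ϖ) h j b (lam - jE ((u : Matrix (Fin 1) (Fin 1) E) 0 0)) ∩
                      {Λ | ∃ B : Submodule 𝒪[E] (Fin 2 → E), B.toAddSubgroup.map φ = Λ ∧
                        ∃ L₃ : Submodule 𝒪[E] (Fin 3 → E), IsSelfDualLattice σ ϖ (!![H₂ 0 0, 0, H₂ 0 1; 0, hW, 0; H₂ 1 0, 0, H₂ 1 1] : Matrix (Fin 3) (Fin 3) E) L₃ ∧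
                          L₃ ⊓ LinearMap.ker ((LinearMap.proj (1 : Fin 3) : (Fin 3 → E) →ₗ[E] E).restrictScalars 𝒪[E]) =
                            B.map ((Matrix.toLin' (!![1, 0; 0, 0; 0, 1] : Matrix (Fin 3) (Fin 2) E)).restrictScalars 𝒪[E]) ∧
                          (∀ c : E, (Pi.single 1 c : Fin 3 → E) ∈ L₃ ↔ Valued.v c ≤ Valued.v ϖ ^ b) ∧
                          (LatticeNearTransvShell ϖ (d % 2) (mstarOfRecord d) ((((endoGL (γ₂, u) : GL (Fin 3) E) : Matrix (Fin 3) (Fin 3) E) - 1)) L₃ ∧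
                            {z : E | ∃ y ∈ L₃, Valued.v ((ϖ ^ (mstarOfRecord d))⁻¹ * (z - pairing σ (!![H₂ 0 0, 0, H₂ 0 1; 0, hW, 0; H₂ 1 0, 0, H₂ 1 1] : Matrix (Fin 3) (Fin 3) E) y (((((endoGL (γ₂, u) : GL (Fin 3) E) : Matrix (Fin 3) (Fin 3) E) - 1)) *ᵥ y))) ≤ 1} =
                              valueSetMod σ ϖ (mstarOfRecord d) (xPlus σ ϖ d))}, f b j Λ : ℕ) : ℤ) -
      ((∑ᶠ Λ ∈ levelSetDep ρ Θ α (jE ϖ) h j b (lam - jE ((u : Matrix (Fin 1) (Fin 1) E) 0 0)) ∩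
                      {Λ | ∃ B : Submodule 𝒪[E] (Fin 2 → E), B.toAddSubgroup.map φ = Λ ∧
                        ∃ L₃ : Submodule 𝒪[E] (Fin 3 → E), IsSelfDualLattice σ ϖ (!![H₂ 0 0, 0, H₂ 0 1; 0, hW, 0; H₂ 1 0, 0, H₂ 1 1] : Matrix (Fin 3) (Fin 3) E) L₃ ∧
                          L₃ ⊓ LinearMap.ker ((LinearMap.proj (1 : Fin 3) : (Fin 3 → E) →ₗ[E] E).restrictScalars 𝒪[E]) =
                            B.map ((Matrix.toLin' (!![1, 0; 0, 0; 0, 1] : Matrix (Fin 3) (Fin 2) E)).restrictScalars 𝒪[E]) ∧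
                          (∀ c : E, (Pi.single 1 c : Fin 3 → E) ∈ L₃ ↔ Valued.v c ≤ Valued.v ϖ ^ b) ∧
                          (LatticeNearTransvShell ϖ (d % 2) (mcOfRecord d) ((((endoGL (γ₂, u) : GL (Fin 3) E) : Matrix (Fin 3) (Fin 3) E) - 1)) L₃ ∧
                            ¬ {z : E | ∃ y ∈ L₃, Valued.v ((ϖ ^ (mstarOfRecord d))⁻¹ * (z - pairing σ (!![H₂ 0 0, 0, H₂ 0 1; 0, hW, 0; H₂ 1 0, 0, H₂ 1 1] : Matrix (Fin 3) (Fin 3) E) y (((((endoGL (γ₂, u) : GL (Fin 3) E) : Matrix (Fin 3) (Fin 3) E) - 1)) *ᵥ y))) ≤ 1} =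
                              valueSetMod σ ϖ (mstarOfRecord d) (xPlus σ ϖ d))}, f b j Λ : ℕ) : ℤ) = 0 := by
  obtain ⟨hσ, hvσ, hϖ, hfix, hdd, h1d, ht⟩ := id hD
  have hjϖ : Valued.v (jE ϖ) = exp (-2 : ℤ) := by rw [c1, hϖ, ← exp_nsmul]; congr 1
  have hjϖle : Valued.v (jE ϖ) ≤ 1 := by rw [hjϖ, ← exp_zero, exp_le_exp]; norm_num
  have hPn : ∀ n : ℕ, Valued.v (jE ϖ) ^ n = exp (-(2 * (n : ℤ))) := fun n => by
    rw [hjϖ, ← exp_nsmul]; congr 1; simp only [nsmul_eq_mul]; ring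
  -- `|α − ρα| = exp(−d_ρ)` from the RamM place package
  have hαρ : Valued.v (α - ρ α) = exp (-(dρ : ℤ)) := by rw [c6, c7.2.2.2.2.1, c5, ← exp_nsmul]; simp
  -- arithmetic of record
  have hdt : d ≤ tE + 1 := d_le_succ_t hσ hfix hϖ hdd ht
  have harith : mcOfRecord d ≤ tE + mstarOfRecord d := by unfold mcOfRecord mstarOfRecord; omega
  have hsc : mstarOfRecord d ≤ mcOfRecord d := mstarOfRecord_le_mcOfRecord d
  -- the smallness `|ν| ≤ |ϖE|^(m_c)` (hence `≤ |ϖE|^(m*)`): `|μ| = exp(−m) ≤ exp(−2m_c)` and `|jE(2(u₀₀ − 1))| = |2(u₀₀ − 1)|² ≤ |ϖ|^{2(tE + m⋆)} ≤ |jE ϖ|^{m_c}`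
  have hν : Valued.v ((lam - 1) + (jE ((u : Matrix (Fin 1) (Fin 1) E) 0 0) - 1)) ≤ Valued.v (jE ϖ) ^ mcOfRecord d := by
    have e : (lam - 1) + (jE ((u : Matrix (Fin 1) (Fin 1) E) 0 0) - 1) =
        (lam - jE ((u : Matrix (Fin 1) (Fin 1) E) 0 0)) + jE (2 * (((u : Matrix (Fin 1) (Fin 1) E) 0 0) - 1)) := by
      rw [map_mul, map_sub, map_one, map_ofNat]; ring
    rw [e]
    refine (Valuation.map_add _ _ _).trans (max_le ?_ ?_)
    · rw [hm, hPn, exp_le_exp]; omega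
    · have hum' : Valued.v (((u : Matrix (Fin 1) (Fin 1) E) 0 0) - 1) ≤ Valued.v ϖ ^ mstarOfRecord d := by
        have h0 := hum
        rwa [map_pow] at h0
      have h2u1 : Valued.v (2 * (((u : Matrix (Fin 1) (Fin 1) E) 0 0) - 1)) ≤ Valued.v ϖ ^ (tE + mstarOfRecord d) := by
        rw [map_mul, ht, pow_add]
        exact mul_le_mul' le_rfl hum'
      have h2u : Valued.v (jE (2 * (((u : Matrix (Fin 1) (Fin 1) E) 0 0) - 1))) ≤ Valued.v (jE ϖ) ^ (tE + mstarOfRecord d) := by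
        rw [c1, c1, ← pow_mul, mul_comm 2 (tE + mstarOfRecord d), pow_mul, pow_two, pow_two]
        exact mul_le_mul' h2u1 h2u1
      exact h2u.trans (pow_le_pow_right_of_le_one' hjϖle harith)
  have hν' : Valued.v ((lam - 1) + (jE ((u : Matrix (Fin 1) (Fin 1) E) 0 0) - 1)) ≤ Valued.v (jE ϖ) ^ mstarOfRecord d :=
    hν.trans (pow_le_pow_right_of_le_one' hjϖle hsc)
  -- both labelled subsets are empty
  have hplus : levelSetDep ρ Θ α (jE ϖ) h j b (lam - jE ((u : Matrix (Fin 1) (Fin 1) E) 0 0)) ∩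
                      {Λ | ∃ B : Submodule 𝒪[E] (Fin 2 → E), B.toAddSubgroup.map φ = Λ ∧
                        ∃ L₃ : Submodule 𝒪[E] (Fin 3 → E), IsSelfDualLattice σ ϖ (!![H₂ 0 0, 0, H₂ 0 1; 0, hW, 0; H₂ 1 0, 0, H₂ 1 1] : Matrix (Fin 3) (Fin 3) E) L₃ ∧
                          L₃ ⊓ LinearMap.ker ((LinearMap.proj (1 : Fin 3) : (Fin 3 → E) →ₗ[E] E).restrictScalars 𝒪[E]) =
                            B.map ((Matrix.toLin' (!![1, 0; 0, 0; 0, 1] : Matrix (Fin 3) (Fin 2) E)).restrictScalars 𝒪[E]) ∧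
                          (∀ c : E, (Pi.single 1 c : Fin 3 → E) ∈ L₃ ↔ Valued.v c ≤ Valued.v ϖ ^ b) ∧
                          (LatticeNearTransvShell ϖ (d % 2) (mstarOfRecord d) ((((endoGL (γ₂, u) : GL (Fin 3) E) : Matrix (Fin 3) (Fin 3) E) - 1)) L₃ ∧
                            {z : E | ∃ y ∈ L₃, Valued.v ((ϖ ^ (mstarOfRecord d))⁻¹ * (z - pairing σ (!![H₂ 0 0, 0, H₂ 0 1; 0, hW, 0; H₂ 1 0, 0, H₂ 1 1] : Matrix (Fin 3) (Fin 3) E) y (((((endoGL (γ₂, u) : GL (Fin 3) E) : Matrix (Fin 3) (Fin 3) E) - 1)) *ᵥ y))) ≤ 1} =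
                              valueSetMod σ ϖ (mstarOfRecord d) (xPlus σ ϖ d))} = ∅ :=
    levelSetDep_inter_shell_eq_empty_of_top_ramM σ hσ hvσ hϖ hH₂ hH₂σ hhW jE hρρ hvρ hα hα1 hint hΘΘ hΘρ hvΘ hjv hjfix hjpow hϖmax hjϖ φ hφs hφi hφo hφγ hlam hΘh hh
      hform u hb1 hlamj hm hjl hαρ hν' (by omega) (d % 2) _
  have hminus : levelSetDep ρ Θ α (jE ϖ) h j b (lam - jE ((u : Matrix (Fin 1) (Fin 1) E) 0 0)) ∩
                      {Λ | ∃ B : Submodule 𝒪[E] (Fin 2 → E), B.toAddSubgroup.map φ = Λ ∧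
                        ∃ L₃ : Submodule 𝒪[E] (Fin 3 → E), IsSelfDualLattice σ ϖ (!![H₂ 0 0, 0, H₂ 0 1; 0, hW, 0; H₂ 1 0, 0, H₂ 1 1] : Matrix (Fin 3) (Fin 3) E) L₃ ∧
                          L₃ ⊓ LinearMap.ker ((LinearMap.proj (1 : Fin 3) : (Fin 3 → E) →ₗ[E] E).restrictScalars 𝒪[E]) =
                            B.map ((Matrix.toLin' (!![1, 0; 0, 0; 0, 1] : Matrix (Fin 3) (Fin 2) E)).restrictScalars 𝒪[E]) ∧
                          (∀ c : E, (Pi.single 1 c : Fin 3 → E) ∈ L₃ ↔ Valued.v c ≤ Valued.v ϖ ^ b) ∧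
                          (LatticeNearTransvShell ϖ (d % 2) (mcOfRecord d) ((((endoGL (γ₂, u) : GL (Fin 3) E) : Matrix (Fin 3) (Fin 3) E) - 1)) L₃ ∧
                            ¬ {z : E | ∃ y ∈ L₃, Valued.v ((ϖ ^ (mstarOfRecord d))⁻¹ * (z - pairing σ (!![H₂ 0 0, 0, H₂ 0 1; 0, hW, 0; H₂ 1 0, 0, H₂ 1 1] : Matrix (Fin 3) (Fin 3) E) y (((((endoGL (γ₂, u) : GL (Fin 3) E) : Matrix (Fin 3) (Fin 3) E) - 1)) *ᵥ y))) ≤ 1} =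
                              valueSetMod σ ϖ (mstarOfRecord d) (xPlus σ ϖ d))} = ∅ :=
    levelSetDep_inter_shell_eq_empty_of_top_ramM σ hσ hvσ hϖ hH₂ hH₂σ hhW jE hρρ hvρ hα hα1 hint hΘΘ hΘρ hvΘ hjv hjfix hjpow hϖmax hjϖ φ hφs hφi hφo hφγ hlam hΘh hh
      hform u hb1 hlamj hm hjl hαρ hν (by omega) (d % 2) _
  rw [hplus, hminus, finsum_mem_empty]
  simp

end Summit.HodgeConjecture.HodgeConjecture.Cruxes.H413.F0P3cDyRamTopConeCellEmptyRamM

end
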